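import Summits.HubbardSuperconductivity.HubbardSuperconductivity.Theses.FunctionFieldCertificate
import Summits.HubbardSuperconductivity.HubbardSuperconductivity.Theorems.FunctionFieldCertificateMesoscopicPairOrderSplit
import Summits.HubbardSuperconductivity.HubbardSuperconductivity.Theorems.FunctionFieldCertificateMesoscopicPairOrderSeedForms
import Summits.HubbardSuperconductivity.HubbardSuperconductivity.Theorems.FunctionFieldCertificateMesoscopicPairOrderDoublingCore
import HarnessLib

/-!
# `MesoscopicPairOrder` (stmt-HubbardSuperconductivity-7331), line `redirect_birth`:
# the typed POSITION of the load-bearing stub (D) `stub_coherenceDoubling` — given (A), crux ⟺ (Q) ∧ (D)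

Support file for the crux (route `FunctionFieldCertificate`, pole-free half; lead c9 of line
`redirect_birth`, planner cstrat-r1), file 2/2 (file 1/2 = `…DoublingCore`: the pointwise lemmas). The line
cuts piece (B) `LeakBeatingBlockPairSeed` of the split along the SCALE axis into

* (Q) a pair-fluctuation FLOOR at every fixed block scale, `c(U,δ,R) ≤ T_R(ψ)/L²`, and
* (D) a DOUBLING LAW `θ · T_R(ψ) ≤ T_{2R}(ψ)`, `θ > 2`, for all `R ≥ R₁`,

in every normalised `(N_L, S^z = 0)`-sector ground state `ψ` of `hubbardTorus 2 L 1 U` on all large even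
tori, where `T_R(ψ) = Σ_{x,y} Πᵢ (1 - |(y - x)ᵢ|_L/R)₊ Re⟨P_x ψ, P_y ψ⟩`, `P_x = localPair dWaveFormFactor L x`.
The line card asserts, without proof, that (D) carries "all the U(1)-breaking content of (B)". This file
makes the position of the cut a theorem (nothing here proves (Q), (D) or the crux, which are open physics):

* `floor_and_doubling_of_mesoscopicPairOrder` — **necessity**: given piece (A) `GoldstonePairProfile`, the
  crux implies that at SOME `(U, δ)` both the (Q)-body (every scale) and the (D)-body (every `θ < 4`) hold
  ((A) ⇒ `WindowInfraredBound`, so the crux gives uniform sector pair order at a point, and file 1/2 applies).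
* `iterate_doubling_of_floor` + `superlinearAt_of_floorAt_of_doublingAt` (pointwise) +
  `mesoscopicPairOrder_of_floor_and_doubling` — **sufficiency** (the line's
  composition with hypotheses in place of stubs): (A) and [at some `(U, δ)`: the (Q)-body at every scale and
  the (D)-body for ONE `θ > 2`] ⇒ the crux (induction on dyadic doublings ⇒ super-linear block pair order ⇒
  (B) by `leakBeatingBlockPairSeed_iff_superlinear` ⇒ crux by `mesoscopicPairOrder_of_subs`).
* `mesoscopicPairOrder_iff_floor_and_doubling` — hence, GIVEN (A), the crux is EQUIVALENT to
  "(Q)-body ∧ (D)-body at a common point" (registered form `mesoscopicPairOrderIffFloorAndDoubling`).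
  Reading for the line: the registered stubs (Q), (D) differ from an exact reformulation of the crux only by
  (i) the box `U ∈ (0,6]`, `δ ∈ [1/10, 3/10]` imposed on the witness and (ii) (Q) being asked at EVERY point
  of that box instead of at the witness; neither stub alone is the crux ((D) holds vacuously on `T ≡ 0`
  families, (Q) asks no growth), and within the pair all symmetry-breaking content is in (D)'s rate.

Sources: Kennedy–Lieb–Shastry, PRL 61 (1988) 2582 [KLS1988PRL] (zero mode of an order operator dominates
a positive-definite box average); Dyson–Lieb–Simon, J. Stat. Phys. 18 (1978) 335, Thm 4.2
[DysonLiebSimon1978]; Fröhlich–Spencer, CMP 81 (1981) 527 (scale-by-scale propagation of coherence — the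
shape of (D)); Stein–Shakarchi, *Fourier Analysis* (2003), Ch. 2 (Fejér kernel). Folklore; no definition
is introduced and no registered stub, piece or the crux is claimed.
-/

noncomputable section

-- the summit namespace repeats the problem name by design (D-0017)
set_option linter.dupNamespace false

namespace Summit.HubbardSuperconductivity.HubbardSuperconductivity.Theorems.FunctionFieldCertificate

open Matrix Finset Filter
open Literature.Probability.LatticeModels Literature.MathematicalPhysics.QuantumLattice
open Summit.HubbardSuperconductivity.HubbardSuperconductivity.Theses.FunctionFieldCertificate
open scoped ComplexOrder ComplexConjugate

/-! ### Necessity and sufficiency of "(Q) ∧ (D) at a common point", given piece (A) -/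

/-- **NECESSITY (given (A))**: the Goldstone pair profile (A) and the crux `MesoscopicPairOrder` imply
that at SOME `U > 0`, `δ ∈ (0, 1/2)` the body of (Q) holds at every scale `R > 0` AND the body of (D)
holds for every `θ < 4`. Proof: (A) ⇒ `WindowInfraredBound` (`windowInfraredBound_of_goldstonePairProfile`),
so the crux gives uniform sector pair order at a point (`uniformPairOrder_of_meso_window`); then
`fluctuationFloor_of_uniformPairOrderAt` and `coherenceDoubling_of_uniformPairOrderAt_of_profileAt`.
(The registered stubs restrict the point to the box `(0,6] × [1/10,3/10]` and ask (Q) on the whole box —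
the only respects in which they exceed the crux given (A).) [folklore] -/
theorem floor_and_doubling_of_mesoscopicPairOrder
    (hA : ∀ U : ℝ, 0 < U → ∀ δ ∈ Set.Ioo (0:ℝ) (1 / 2), ∃ S A : ℝ, 0 ≤ S ∧ 0 ≤ A ∧ ∃ L₀ : ℕ,
      ∀ (L : ℕ) [NeZero L], L₀ ≤ L → Even L →
        ∀ ψ : Fock (Orb (FermionTorus 2 L)), star ψ ⬝ᵥ ψ = 1 →
          IsGroundStateInSector (hubbardTorus 2 L 1 U) (2 * ⌊(1 - δ) * (L : ℝ) ^ 2 / 2⌋₊) 0 ψ →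
            ∀ m : TorusSite 2 L, m ≠ 0 →
              pairStructureFactor dWaveFormFactor L ψ m ≤ S + A / Real.sqrt (momentumNormSq L m))
    (hM : MesoscopicPairOrder) :
    ∃ U : ℝ, 0 < U ∧ ∃ δ ∈ Set.Ioo (0:ℝ) (1 / 2),
      (∀ R : ℕ, 0 < R → ∃ c : ℝ, 0 < c ∧ ∃ L₀ : ℕ, ∀ (L : ℕ) [NeZero L], L₀ ≤ L → Even L →
        ∀ ψ : Fock (Orb (FermionTorus 2 L)), star ψ ⬝ᵥ ψ = 1 →
          IsGroundStateInSector (hubbardTorus 2 L 1 U) (2 * ⌊(1 - δ) * (L : ℝ) ^ 2 / 2⌋₊) 0 ψ →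
            c ≤ (∑ x : TorusSite 2 L, ∑ y : TorusSite 2 L,
              (∏ i : Fin 2, max 0 (1 - |(((y i - x i).valMinAbs : ℤ) : ℝ)| / (R : ℝ))) *
                (star (localPair dWaveFormFactor L x *ᵥ ψ) ⬝ᵥ (localPair dWaveFormFactor L y *ᵥ ψ)).re) /
              (L : ℝ) ^ 2) ∧
      (∀ θ : ℝ, θ < 4 → ∃ R₁ : ℕ, ∀ R : ℕ, R₁ ≤ R → ∃ L₀ : ℕ, ∀ (L : ℕ) [NeZero L], L₀ ≤ L → Even L →
        ∀ ψ : Fock (Orb (FermionTorus 2 L)), star ψ ⬝ᵥ ψ = 1 →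
          IsGroundStateInSector (hubbardTorus 2 L 1 U) (2 * ⌊(1 - δ) * (L : ℝ) ^ 2 / 2⌋₊) 0 ψ →
            θ * (∑ x : TorusSite 2 L, ∑ y : TorusSite 2 L,
              (∏ i : Fin 2, max 0 (1 - |(((y i - x i).valMinAbs : ℤ) : ℝ)| / (R : ℝ))) *
                (star (localPair dWaveFormFactor L x *ᵥ ψ) ⬝ᵥ (localPair dWaveFormFactor L y *ᵥ ψ)).re) ≤
            (∑ x : TorusSite 2 L, ∑ y : TorusSite 2 L,
              (∏ i : Fin 2, max 0 (1 - |(((y i - x i).valMinAbs : ℤ) : ℝ)| / ((2 * R : ℕ) : ℝ))) *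
                (star (localPair dWaveFormFactor L x *ᵥ ψ) ⬝ᵥ
                  (localPair dWaveFormFactor L y *ᵥ ψ)).re)) := by
  obtain ⟨U, hU, δ, hδ, a, ha, hupo⟩ :=
    uniformPairOrder_of_meso_window hM (windowInfraredBound_of_goldstonePairProfile hA)
  obtain ⟨S, A, hS, hA0, hprof⟩ := hA U hU δ hδ
  exact ⟨U, hU, δ, hδ, fluctuationFloor_of_uniformPairOrderAt ha hupo,
    coherenceDoubling_of_uniformPairOrderAt_of_profileAt hS hA0 ha hprof hupo⟩

/-- **Iterated doubling from a floor** (bookkeeping of the line's induction on scales, hypotheses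
explicit): a floor `c ≤ T_R/L²` at scale `R` and the doubling law `θ T_{R'} ≤ T_{2R'}` for all
`R' ≥ R₁`, `R₁ ≤ R`, `θ ≥ 0` (each eventually in even `L`, every sector GS) give
`θ^k c ≤ T_{2^k R}/L²` eventually, for every `k`. [folklore] -/
theorem iterate_doubling_of_floor {U δ θ c : ℝ} {R R₁ : ℕ} (hθ : 0 ≤ θ) (hR₁ : R₁ ≤ R)
    (hQ : ∃ L₀ : ℕ, ∀ (L : ℕ) [NeZero L], L₀ ≤ L → Even L →
      ∀ ψ : Fock (Orb (FermionTorus 2 L)), star ψ ⬝ᵥ ψ = 1 →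
        IsGroundStateInSector (hubbardTorus 2 L 1 U) (2 * ⌊(1 - δ) * (L : ℝ) ^ 2 / 2⌋₊) 0 ψ →
          c ≤ (∑ x : TorusSite 2 L, ∑ y : TorusSite 2 L,
            (∏ i : Fin 2, max 0 (1 - |(((y i - x i).valMinAbs : ℤ) : ℝ)| / (R : ℝ))) *
              (star (localPair dWaveFormFactor L x *ᵥ ψ) ⬝ᵥ (localPair dWaveFormFactor L y *ᵥ ψ)).re) /
            (L : ℝ) ^ 2)
    (hD : ∀ R' : ℕ, R₁ ≤ R' → ∃ L₀ : ℕ, ∀ (L : ℕ) [NeZero L], L₀ ≤ L → Even L →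
      ∀ ψ : Fock (Orb (FermionTorus 2 L)), star ψ ⬝ᵥ ψ = 1 →
        IsGroundStateInSector (hubbardTorus 2 L 1 U) (2 * ⌊(1 - δ) * (L : ℝ) ^ 2 / 2⌋₊) 0 ψ →
          θ * (∑ x : TorusSite 2 L, ∑ y : TorusSite 2 L,
            (∏ i : Fin 2, max 0 (1 - |(((y i - x i).valMinAbs : ℤ) : ℝ)| / (R' : ℝ))) *
              (star (localPair dWaveFormFactor L x *ᵥ ψ) ⬝ᵥ (localPair dWaveFormFactor L y *ᵥ ψ)).re) ≤
          (∑ x : TorusSite 2 L, ∑ y : TorusSite 2 L,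
            (∏ i : Fin 2, max 0 (1 - |(((y i - x i).valMinAbs : ℤ) : ℝ)| / ((2 * R' : ℕ) : ℝ))) *
              (star (localPair dWaveFormFactor L x *ᵥ ψ) ⬝ᵥ (localPair dWaveFormFactor L y *ᵥ ψ)).re)) :
    ∀ k : ℕ, ∃ L₀ : ℕ, ∀ (L : ℕ) [NeZero L], L₀ ≤ L → Even L →
      ∀ ψ : Fock (Orb (FermionTorus 2 L)), star ψ ⬝ᵥ ψ = 1 →
        IsGroundStateInSector (hubbardTorus 2 L 1 U) (2 * ⌊(1 - δ) * (L : ℝ) ^ 2 / 2⌋₊) 0 ψ →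
          θ ^ k * c ≤ (∑ x : TorusSite 2 L, ∑ y : TorusSite 2 L,
            (∏ i : Fin 2, max 0 (1 - |(((y i - x i).valMinAbs : ℤ) : ℝ)| / ((2 ^ k * R : ℕ) : ℝ))) *
              (star (localPair dWaveFormFactor L x *ᵥ ψ) ⬝ᵥ (localPair dWaveFormFactor L y *ᵥ ψ)).re) /
            (L : ℝ) ^ 2 := by
  intro k
  induction k with
  | zero =>
      obtain ⟨L₀, h⟩ := hQ
      refine ⟨L₀, fun L _ hL hE ψ hψ hgs => ?_⟩
      simpa only [pow_zero, one_mul] using h L hL hE ψ hψ hgs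
  | succ k ih =>
      obtain ⟨L₁, h₁⟩ := ih
      have hscale : R₁ ≤ 2 ^ k * R := le_trans hR₁ (Nat.le_mul_of_pos_left R (Nat.two_pow_pos k))
      obtain ⟨L₂, h₂⟩ := hD (2 ^ k * R) hscale
      refine ⟨max L₁ L₂, fun L _ hL hE ψ hψ hgs => ?_⟩
      have a := h₁ L (le_of_max_le_left hL) hE ψ hψ hgs
      have b := h₂ L (le_of_max_le_right hL) hE ψ hψ hgs
      have hLpos : (0 : ℝ) < L := Nat.cast_pos.2 (Nat.pos_of_ne_zero (NeZero.ne L))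
      have hL2 : (0 : ℝ) < (L : ℝ) ^ 2 := by positivity
      have e : 2 ^ (k + 1) * R = 2 * (2 ^ k * R) := by ring
      rw [e]
      rw [le_div_iff₀ hL2] at a ⊢
      calc θ ^ (k + 1) * c * (L : ℝ) ^ 2 = θ * (θ ^ k * c * (L : ℝ) ^ 2) := by ring
        _ ≤ θ * (∑ x : TorusSite 2 L, ∑ y : TorusSite 2 L,
            (∏ i : Fin 2, max 0 (1 - |(((y i - x i).valMinAbs : ℤ) : ℝ)| / ((2 ^ k * R : ℕ) : ℝ))) *
              (star (localPair dWaveFormFactor L x *ᵥ ψ) ⬝ᵥ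
                (localPair dWaveFormFactor L y *ᵥ ψ)).re) := mul_le_mul_of_nonneg_left a hθ
        _ ≤ _ := b

/-- **Floor ∧ doubling ⇒ super-linear block pair order, AT A POINT** (the line's induction on scales with
hypotheses in place of stubs): at `(U, δ)`, the (Q)-body at every scale and the (D)-body for one `θ > 2`
give, for every `C`, one block scale `R₀ > 0` with `C · R₀ ≤ T_{R₀}(ψ)/L²` eventually in even `L`, every
normalised sector ground state (floor at `R = max R₁ 1`, `k` doublings with `(θ/2)^k ≥ C R/c`). [folklore] -/
theorem superlinearAt_of_floorAt_of_doublingAt {U δ θ : ℝ} {R₁ : ℕ} (hθ : 2 < θ)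
    (hQ : ∀ R : ℕ, 0 < R → ∃ c : ℝ, 0 < c ∧ ∃ L₀ : ℕ, ∀ (L : ℕ) [NeZero L], L₀ ≤ L → Even L →
        ∀ ψ : Fock (Orb (FermionTorus 2 L)), star ψ ⬝ᵥ ψ = 1 →
          IsGroundStateInSector (hubbardTorus 2 L 1 U) (2 * ⌊(1 - δ) * (L : ℝ) ^ 2 / 2⌋₊) 0 ψ →
            c ≤ (∑ x : TorusSite 2 L, ∑ y : TorusSite 2 L,
              (∏ i : Fin 2, max 0 (1 - |(((y i - x i).valMinAbs : ℤ) : ℝ)| / (R : ℝ))) *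
                (star (localPair dWaveFormFactor L x *ᵥ ψ) ⬝ᵥ (localPair dWaveFormFactor L y *ᵥ ψ)).re) /
              (L : ℝ) ^ 2)
    (hD : ∀ R : ℕ, R₁ ≤ R → ∃ L₀ : ℕ, ∀ (L : ℕ) [NeZero L], L₀ ≤ L → Even L →
        ∀ ψ : Fock (Orb (FermionTorus 2 L)), star ψ ⬝ᵥ ψ = 1 →
          IsGroundStateInSector (hubbardTorus 2 L 1 U) (2 * ⌊(1 - δ) * (L : ℝ) ^ 2 / 2⌋₊) 0 ψ →
            θ * (∑ x : TorusSite 2 L, ∑ y : TorusSite 2 L,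
              (∏ i : Fin 2, max 0 (1 - |(((y i - x i).valMinAbs : ℤ) : ℝ)| / (R : ℝ))) *
                (star (localPair dWaveFormFactor L x *ᵥ ψ) ⬝ᵥ (localPair dWaveFormFactor L y *ᵥ ψ)).re) ≤
            (∑ x : TorusSite 2 L, ∑ y : TorusSite 2 L,
              (∏ i : Fin 2, max 0 (1 - |(((y i - x i).valMinAbs : ℤ) : ℝ)| / ((2 * R : ℕ) : ℝ))) *
                (star (localPair dWaveFormFactor L x *ᵥ ψ) ⬝ᵥ
                  (localPair dWaveFormFactor L y *ᵥ ψ)).re)) :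
    ∀ C : ℝ, ∃ R₀ : ℕ, 0 < R₀ ∧ ∃ L₀ : ℕ, ∀ (L : ℕ) [NeZero L], L₀ ≤ L → Even L →
      ∀ ψ : Fock (Orb (FermionTorus 2 L)), star ψ ⬝ᵥ ψ = 1 →
        IsGroundStateInSector (hubbardTorus 2 L 1 U) (2 * ⌊(1 - δ) * (L : ℝ) ^ 2 / 2⌋₊) 0 ψ →
          C * (R₀ : ℝ) ≤ (∑ x : TorusSite 2 L, ∑ y : TorusSite 2 L,
            (∏ i : Fin 2, max 0 (1 - |(((y i - x i).valMinAbs : ℤ) : ℝ)| / (R₀ : ℝ))) *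
              (star (localPair dWaveFormFactor L x *ᵥ ψ) ⬝ᵥ (localPair dWaveFormFactor L y *ᵥ ψ)).re) /
            (L : ℝ) ^ 2 := by
  intro C
  -- the base scale and its floor
  set R : ℕ := max R₁ 1 with hRdef
  have hRpos : 0 < R := lt_of_lt_of_le Nat.one_pos (le_max_right _ _)
  have hR₁R : R₁ ≤ R := le_max_left _ _
  obtain ⟨c, hc, L_Q, hQ'⟩ := hQ R hRpos
  have hiter := iterate_doubling_of_floor (U := U) (δ := δ) (by linarith : (0:ℝ) ≤ θ) hR₁R ⟨L_Q, hQ'⟩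
    (fun R' hR' => hD R' hR')
  -- choose the number of doublings
  have hθ2 : 1 < θ / 2 := by linarith
  obtain ⟨k, hk⟩ := pow_unbounded_of_one_lt (max C 0 * (R : ℝ) / c) hθ2
  obtain ⟨L₀, hL₀⟩ := hiter k
  refine ⟨2 ^ k * R, by positivity, L₀, fun L _ hL hE ψ hψ hgs => ?_⟩
  have h := hL₀ L hL hE ψ hψ hgs
  have hRreal : (0 : ℝ) < (R : ℝ) := Nat.cast_pos.2 hRpos
  have hkey : C * ((2 ^ k * R : ℕ) : ℝ) ≤ θ ^ k * c := by
    push_cast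
    have h1 : C * (2 ^ k * (R : ℝ)) ≤ max C 0 * (2 ^ k * (R : ℝ)) :=
      mul_le_mul_of_nonneg_right (le_max_left _ _) (by positivity)
    have h2 : max C 0 * (R : ℝ) / c * c = max C 0 * (R : ℝ) := by field_simp
    have h3 : max C 0 * (2 ^ k * (R : ℝ)) = (max C 0 * (R : ℝ) / c) * c * 2 ^ k := by
      rw [h2]; ring
    have h4 : (max C 0 * (R : ℝ) / c) * c * 2 ^ k ≤ (θ / 2) ^ k * c * 2 ^ k := by
      have := hk.le
      gcongr
    have h5 : (θ / 2) ^ k * c * 2 ^ k = θ ^ k * c := by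
      rw [div_pow]
      field_simp
    linarith [h1, h3, h4, h5]
  exact hkey.trans h

/-- **SUFFICIENCY (the line's composition, hypotheses in place of stubs)**: the Goldstone pair profile
(A), together with — at some `U > 0`, `δ ∈ (0, 1/2)` — the (Q)-body at every scale and the (D)-body for
ONE `θ > 2`, imply the crux: `superlinearAt_of_floorAt_of_doublingAt` gives super-linear block pair order
at that point, i.e. (B) (`leakBeatingBlockPairSeed_iff_superlinear`), and `mesoscopicPairOrder_of_subs`
closes with (A). [folklore] -/
theorem mesoscopicPairOrder_of_floor_and_doubling
    (hA : ∀ U : ℝ, 0 < U → ∀ δ ∈ Set.Ioo (0:ℝ) (1 / 2), ∃ S A : ℝ, 0 ≤ S ∧ 0 ≤ A ∧ ∃ L₀ : ℕ,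
      ∀ (L : ℕ) [NeZero L], L₀ ≤ L → Even L →
        ∀ ψ : Fock (Orb (FermionTorus 2 L)), star ψ ⬝ᵥ ψ = 1 →
          IsGroundStateInSector (hubbardTorus 2 L 1 U) (2 * ⌊(1 - δ) * (L : ℝ) ^ 2 / 2⌋₊) 0 ψ →
            ∀ m : TorusSite 2 L, m ≠ 0 →
              pairStructureFactor dWaveFormFactor L ψ m ≤ S + A / Real.sqrt (momentumNormSq L m))
    (hQD : ∃ U : ℝ, 0 < U ∧ ∃ δ ∈ Set.Ioo (0:ℝ) (1 / 2),
      (∀ R : ℕ, 0 < R → ∃ c : ℝ, 0 < c ∧ ∃ L₀ : ℕ, ∀ (L : ℕ) [NeZero L], L₀ ≤ L → Even L →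
        ∀ ψ : Fock (Orb (FermionTorus 2 L)), star ψ ⬝ᵥ ψ = 1 →
          IsGroundStateInSector (hubbardTorus 2 L 1 U) (2 * ⌊(1 - δ) * (L : ℝ) ^ 2 / 2⌋₊) 0 ψ →
            c ≤ (∑ x : TorusSite 2 L, ∑ y : TorusSite 2 L,
              (∏ i : Fin 2, max 0 (1 - |(((y i - x i).valMinAbs : ℤ) : ℝ)| / (R : ℝ))) *
                (star (localPair dWaveFormFactor L x *ᵥ ψ) ⬝ᵥ (localPair dWaveFormFactor L y *ᵥ ψ)).re) /
              (L : ℝ) ^ 2) ∧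
      (∃ θ : ℝ, 2 < θ ∧ ∃ R₁ : ℕ, ∀ R : ℕ, R₁ ≤ R → ∃ L₀ : ℕ, ∀ (L : ℕ) [NeZero L], L₀ ≤ L → Even L →
        ∀ ψ : Fock (Orb (FermionTorus 2 L)), star ψ ⬝ᵥ ψ = 1 →
          IsGroundStateInSector (hubbardTorus 2 L 1 U) (2 * ⌊(1 - δ) * (L : ℝ) ^ 2 / 2⌋₊) 0 ψ →
            θ * (∑ x : TorusSite 2 L, ∑ y : TorusSite 2 L,
              (∏ i : Fin 2, max 0 (1 - |(((y i - x i).valMinAbs : ℤ) : ℝ)| / (R : ℝ))) *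
                (star (localPair dWaveFormFactor L x *ᵥ ψ) ⬝ᵥ (localPair dWaveFormFactor L y *ᵥ ψ)).re) ≤
            (∑ x : TorusSite 2 L, ∑ y : TorusSite 2 L,
              (∏ i : Fin 2, max 0 (1 - |(((y i - x i).valMinAbs : ℤ) : ℝ)| / ((2 * R : ℕ) : ℝ))) *
                (star (localPair dWaveFormFactor L x *ᵥ ψ) ⬝ᵥ
                  (localPair dWaveFormFactor L y *ᵥ ψ)).re))) :
    MesoscopicPairOrder := by
  refine mesoscopicPairOrder_of_subs hA (leakBeatingBlockPairSeed_iff_superlinear.mpr ?_)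
  obtain ⟨U, hU, δ, hδ, hQ, θ, hθ, R₁, hD⟩ := hQD
  exact ⟨U, hU, δ, hδ, superlinearAt_of_floorAt_of_doublingAt hθ hQ hD⟩

/-- **GIVEN (A), THE CRUX ⟺ "(Q) ∧ (D) AT A COMMON POINT".** Under the Goldstone pair profile (A),
`MesoscopicPairOrder` holds iff at some `U > 0`, `δ ∈ (0, 1/2)` every fixed block scale has a positive
GS-uniform floor `c ≤ T_R(ψ)/L²` AND some `θ > 2` propagates pair coherence across all large dyadic scales,
`θ T_R(ψ) ≤ T_{2R}(ψ)`. So line `redirect_birth`'s cut of (B) is, up to the box it imposes on the witness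
and the ∀-box form of (Q), an exact reformulation of the crux given (A): nothing is lost and nothing but the
box is added. [folklore] -/
theorem mesoscopicPairOrder_iff_floor_and_doubling
    (hA : ∀ U : ℝ, 0 < U → ∀ δ ∈ Set.Ioo (0:ℝ) (1 / 2), ∃ S A : ℝ, 0 ≤ S ∧ 0 ≤ A ∧ ∃ L₀ : ℕ,
      ∀ (L : ℕ) [NeZero L], L₀ ≤ L → Even L →
        ∀ ψ : Fock (Orb (FermionTorus 2 L)), star ψ ⬝ᵥ ψ = 1 →
          IsGroundStateInSector (hubbardTorus 2 L 1 U) (2 * ⌊(1 - δ) * (L : ℝ) ^ 2 / 2⌋₊) 0 ψ →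
            ∀ m : TorusSite 2 L, m ≠ 0 →
              pairStructureFactor dWaveFormFactor L ψ m ≤ S + A / Real.sqrt (momentumNormSq L m)) :
    MesoscopicPairOrder ↔ ∃ U : ℝ, 0 < U ∧ ∃ δ ∈ Set.Ioo (0:ℝ) (1 / 2),
      (∀ R : ℕ, 0 < R → ∃ c : ℝ, 0 < c ∧ ∃ L₀ : ℕ, ∀ (L : ℕ) [NeZero L], L₀ ≤ L → Even L →
        ∀ ψ : Fock (Orb (FermionTorus 2 L)), star ψ ⬝ᵥ ψ = 1 →
          IsGroundStateInSector (hubbardTorus 2 L 1 U) (2 * ⌊(1 - δ) * (L : ℝ) ^ 2 / 2⌋₊) 0 ψ →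
            c ≤ (∑ x : TorusSite 2 L, ∑ y : TorusSite 2 L,
              (∏ i : Fin 2, max 0 (1 - |(((y i - x i).valMinAbs : ℤ) : ℝ)| / (R : ℝ))) *
                (star (localPair dWaveFormFactor L x *ᵥ ψ) ⬝ᵥ (localPair dWaveFormFactor L y *ᵥ ψ)).re) /
              (L : ℝ) ^ 2) ∧
      (∃ θ : ℝ, 2 < θ ∧ ∃ R₁ : ℕ, ∀ R : ℕ, R₁ ≤ R → ∃ L₀ : ℕ, ∀ (L : ℕ) [NeZero L], L₀ ≤ L → Even L →
        ∀ ψ : Fock (Orb (FermionTorus 2 L)), star ψ ⬝ᵥ ψ = 1 →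
          IsGroundStateInSector (hubbardTorus 2 L 1 U) (2 * ⌊(1 - δ) * (L : ℝ) ^ 2 / 2⌋₊) 0 ψ →
            θ * (∑ x : TorusSite 2 L, ∑ y : TorusSite 2 L,
              (∏ i : Fin 2, max 0 (1 - |(((y i - x i).valMinAbs : ℤ) : ℝ)| / (R : ℝ))) *
                (star (localPair dWaveFormFactor L x *ᵥ ψ) ⬝ᵥ (localPair dWaveFormFactor L y *ᵥ ψ)).re) ≤
            (∑ x : TorusSite 2 L, ∑ y : TorusSite 2 L,
              (∏ i : Fin 2, max 0 (1 - |(((y i - x i).valMinAbs : ℤ) : ℝ)| / ((2 * R : ℕ) : ℝ))) *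
                (star (localPair dWaveFormFactor L x *ᵥ ψ) ⬝ᵥ
                  (localPair dWaveFormFactor L y *ᵥ ψ)).re)) := by
  constructor
  · intro hM
    obtain ⟨U, hU, δ, hδ, hQ, hD⟩ := floor_and_doubling_of_mesoscopicPairOrder hA hM
    exact ⟨U, hU, δ, hδ, hQ, 3, by norm_num, hD 3 (by norm_num)⟩
  · exact mesoscopicPairOrder_of_floor_and_doubling hA

/-- Registered sub-goal form (line `redirect_birth`, lead c9): GIVEN piece (A), the crux ⟺ "(Q)-body at
every scale ∧ (D)-body for some `θ > 2`, at a common point" — `mesoscopicPairOrder_iff_floor_and_doubling`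
with the hypothesis as an implication. [folklore] -/
theorem mesoscopicPairOrderIffFloorAndDoubling : (∀ U : ℝ, 0 < U → ∀ δ ∈ Set.Ioo (0:ℝ) (1 / 2), ∃ S A : ℝ, 0 ≤ S ∧ 0 ≤ A ∧ ∃ L₀ : ℕ, ∀ (L : ℕ) [NeZero L], L₀ ≤ L → Even L → ∀ ψ : Fock (Orb (FermionTorus 2 L)), star ψ ⬝ᵥ ψ = 1 → IsGroundStateInSector (hubbardTorus 2 L 1 U) (2 * ⌊(1 - δ) * (L : ℝ) ^ 2 / 2⌋₊) 0 ψ → ∀ m : TorusSite 2 L, m ≠ 0 → pairStructureFactor dWaveFormFactor L ψ m ≤ S + A / Real.sqrt (momentumNormSq L m)) → (Summit.HubbardSuperconductivity.HubbardSuperconductivity.Theses.FunctionFieldCertificate.MesoscopicPairOrder ↔ ∃ U : ℝ, 0 < U ∧ ∃ δ ∈ Set.Ioo (0:ℝ) (1 / 2), (∀ R : ℕ, 0 < R → ∃ c : ℝ, 0 < c ∧ ∃ L₀ : ℕ, ∀ (L : ℕ) [NeZero L], L₀ ≤ L → Even L → ∀ ψ : Fock (Orb (FermionTorus 2 L)),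 star ψ ⬝ᵥ ψ = 1 → IsGroundStateInSector (hubbardTorus 2 L 1 U) (2 * ⌊(1 - δ) * (L : ℝ) ^ 2 / 2⌋₊) 0 ψ → c ≤ (∑ x : TorusSite 2 L, ∑ y : TorusSite 2 L, (∏ i : Fin 2, max 0 (1 - |(((y i - x i).valMinAbs : ℤ) : ℝ)| / (R : ℝ))) * (star (localPair dWaveFormFactor L x *ᵥ ψ) ⬝ᵥ (localPair dWaveFormFactor L y *ᵥ ψ)).re) / (L : ℝ) ^ 2) ∧ (∃ θ : ℝ, 2 < θ ∧ ∃ R₁ : ℕ, ∀ R : ℕ, R₁ ≤ R → ∃ L₀ : ℕ, ∀ (L : ℕ) [NeZero L], L₀ ≤ L → Even L → ∀ ψ : Fock (Orb (FermionTorus 2 L)), star ψ ⬝ᵥ ψ = 1 → IsGroundStateInSector (hubbardTorus 2 L 1 U) (2 * ⌊(1 - δ) * (L : ℝ) ^ 2 / 2⌋₊) 0 ψ → θ * (∑ x : TorusSite 2 L, ∑ y : TorusSite 2 L, (∏ i : Fin 2, max 0 (1 - |(((y i - x i).valMinAbs : ℤ) : ℝ)| / (R : ℝ))) * (star (localPair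 dWaveFormFactor L x *ᵥ ψ) ⬝ᵥ (localPair dWaveFormFactor L y *ᵥ ψ)).re) ≤ (∑ x : TorusSite 2 L, ∑ y : TorusSite 2 L, (∏ i : Fin 2, max 0 (1 - |(((y i - x i).valMinAbs : ℤ) : ℝ)| / ((2 * R : ℕ) : ℝ))) * (star (localPair dWaveFormFactor L x *ᵥ ψ) ⬝ᵥ (localPair dWaveFormFactor L y *ᵥ ψ)).re))) :=
  mesoscopicPairOrder_iff_floor_and_doubling

end Summit.HubbardSuperconductivity.HubbardSuperconductivity.Theorems.FunctionFieldCertificate
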